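import Literature.RepresentationTheory.FiniteGroups.InvariantLineOfFixedVectors
import HarnessLib

/-!
# A normal subgroup all of whose elements fix a non-zero vector of an irreducible plane acts trivially

Topic `Literature/RepresentationTheory/FiniteGroups`; theorems only (no definition, no named fact,
no instance). Companion of `InvariantLineOfFixedVectors` (the dimension-`2`, trace-free substitute
for the Brauer–Nesbitt step of "Eisenstein Frobenius traces force a reducible residual
representation", Darmon–Diamond–Taylor, *Fermat's Last Theorem*, CDM 1995, Prop. 2.6 (b)), in the
RELATIVE form needed for Eisenstein systems with non-trivial characters (loc. cit., Lemma 4.12: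
"if `𝔪̃` is Eisenstein then proposition 2.6 implies that `ρ_𝔪` restricted to `G_{ℚ(ζ_{Nℓ})}` has
trivial semisimplification from which it follows that `ρ_𝔪` is also reducible"): there the
hypothesis "every element fixes a non-zero vector" is only available on the NORMAL subgroup
`H = Gal(ℚ̄/ℚ(ζ_M))` of `Γ = Γ_ℚ`, and the conclusion wanted is that `H` acts trivially on the
`Γ`-irreducible plane (so that `Γ` acts through the abelian quotient `Γ/H`).

## Main result (proved)

* `Literature.RepresentationTheory.FiniteGroups.Representation.smul_eq_self_of_normal_of_forall_exists_fixed`: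
  let `A` be an `𝔽_p`-plane with an action of a group `Γ` by additive automorphisms admitting no
  `Γ`-stable subgroup other than `⊥` and `⊤` (the form of irreducibility of
  `WeierstrassCurve.HasIrreducibleModPGaloisRep`), and `H ⊴ Γ` a normal subgroup every element of
  which fixes a non-zero element of `A`. Then every element of `H` fixes every element of `A`.

## Proof

By `exists_finrank_eq_one_invariant_of_forall_exists_fixed` (parent file) `H` stabilises a line
`L`. An element `h ∈ H` with a non-zero fixed vector inside `L` fixes `L` pointwise (`L` is spanned
by it); one with a fixed vector `a ∉ L` acts trivially on `A/L` (`A = L ⊕ 𝔽_p a` and `h L ⊆ L`).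
These two subsets of `H` are subgroups covering `H`, so one of them is all of `H` (a group is not
the union of two proper subgroups: if `h₁ ∉` the first and `h₂ ∉` the second, `h₁ h₂` lies in
neither). If `H` fixes `L` pointwise, the fixed vectors `A^H ⊇ L ≠ 0` form a `Γ`-stable subgroup
(normality), hence `A^H = A`. If `H` acts trivially on `A/L`, the subgroup generated by the
`h a − a` (`h ∈ H`) is `Γ`-stable (normality) and contained in `L ≠ A`, hence `⊥`, i.e. `H` acts
trivially. Consumer: `Literature.NumberTheory.EllipticCurves.ModPIrreducibleNotEisensteinProofs`
(`E[p]` irreducible, `p` odd ⟹ `a_ℓ(E) mod p` is not an Eisenstein system). A parallel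
Summits-side statement (fixed-point-or-stable-subgroup form) is
`Summit.BirchSwinnertonDyer.Rank1Residual.GaloisImage.EigenvalueOneNormalSubgroup` (cell
`b2b-bsdres`); the present file is the Literature-side tool (Literature does not import Summits).

## References

* H. Darmon, F. Diamond, R. Taylor, *Fermat's Last Theorem*, Current Developments in Mathematics
  1995, International Press, Prop. 2.6 (b) (p. 53) and Lemma 4.12 (p. 120).
* J.-P. Serre, *Propriétés galoisiennes des points d'ordre fini des courbes elliptiques*, Invent.
  Math. 15 (1972), §2 (subgroups of `GL₂(𝔽_p)`).
* C. W. Curtis, I. Reiner, *Representation theory of finite groups and associative algebras*,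
  Wiley 1962, (30.16) (Brauer–Nesbitt theorem).
-/

open Module

namespace Literature.RepresentationTheory.FiniteGroups.Representation

section ZModPlaneNormal

variable {p : ℕ} [Fact p.Prime] {A : Type*} [AddCommGroup A] [Module (ZMod p) A]
  {Γ : Type*} [Group Γ] [DistribMulAction Γ A]

/-- **Relative invariant-line lemma.** Let `A` be an `𝔽_p`-plane with an action of a group `Γ`
by additive automorphisms which is irreducible (no `Γ`-stable subgroup other than `⊥`, `⊤`), and
let `H ⊴ Γ` be a normal subgroup every element of which fixes a non-zero element of `A`. Then `H`
acts trivially on `A`. Proof: by the invariant-line lemma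
(`Representation.exists_finrank_eq_one_invariant_of_forall_exists_fixed`) `H` stabilises a line
`L`; an element of `H` with a fixed vector in `L` fixes `L` pointwise, one with a fixed vector
outside `L` acts trivially on `A/L`; these two subgroups cover `H`, so one of them is `H`; in the
first case the `Γ`-stable (normality) subgroup `A^H ⊇ L` is `⊤`, in the second the `Γ`-stable
subgroup generated by the `h a − a ⊆ L` is `⊥`. This is the group-theoretic content, in
dimension `2` and without traces, of the step "proposition 2.6 implies that `ρ_𝔪` restricted to
`G_{ℚ(ζ_{Nℓ})}` has trivial semisimplification from which it follows that `ρ_𝔪` is also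
reducible" in the proof of Darmon–Diamond–Taylor's Lemma 4.12 (there `H = G_{ℚ(ζ_{Nℓ})} ⊴ G_ℚ`;
contrapositive form: if the normal subgroup `H` does not act trivially, the plane is reducible).
[cite: DarmonDiamondTaylor1995, Lemma 4.12 (p. 120), proof; with Prop. 2.6 (b) (p. 53)] -/
theorem smul_eq_self_of_normal_of_forall_exists_fixed (h2 : finrank (ZMod p) A = 2)
    (H : Subgroup Γ) (hH : H.Normal) (hfix : ∀ σ ∈ H, ∃ a : A, a ≠ 0 ∧ σ • a = a)
    (hirr : ∀ B : AddSubgroup A, (∀ σ : Γ, ∀ a ∈ B, σ • a ∈ B) → B = ⊥ ∨ B = ⊤) :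
    ∀ σ ∈ H, ∀ a : A, σ • a = a := by
  haveI : FiniteDimensional (ZMod p) A := Module.finite_of_finrank_eq_succ h2
  -- the `𝔽_p`-linear representation of `H` underlying the action
  let ρ : _root_.Representation (ZMod p) H A :=
    { toFun := fun h ↦ (DistribSMul.toAddMonoidHom A (h : Γ)).toZModLinearMap p
      map_one' := by ext; simp
      map_mul' := fun g h ↦ by ext; simp [mul_smul] }
  have hρ : ∀ (h : H) (a : A), ρ h a = (h : Γ) • a := fun _ _ ↦ rfl
  have hfix' : ∀ h : H, ∃ a : A, a ≠ 0 ∧ ρ h a = a := fun h ↦ hfix h h.2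
  obtain ⟨L, hL1, hL⟩ :=
    exists_finrank_eq_one_invariant_of_forall_exists_fixed ρ h2 hfix'
  have hLbt := ne_bot_and_ne_top_of_finrank_eq_one h2 hL1
  obtain ⟨x₀, hx₀L, hx₀⟩ := Submodule.exists_mem_ne_zero_of_ne_bot hLbt.1
  -- each `h ∈ H` fixes `L` pointwise or acts trivially on `A / L`
  have hdich : ∀ h : H, (∀ x ∈ L, ρ h x = x) ∨ (∀ a : A, ρ h a - a ∈ L) := by
    intro h
    obtain ⟨a, ha0, ha⟩ := hfix' h
    by_cases haL : a ∈ L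
    · left
      intro x hx
      have hspan : (ZMod p) ∙ a = L :=
        eq_of_finrank_eq_one_of_mem (finrank_span_singleton ha0) hL1 ha0
          (Submodule.mem_span_singleton_self a) haL
      rw [← hspan, Submodule.mem_span_singleton] at hx
      obtain ⟨c, rfl⟩ := hx
      rw [map_smul, ha]
    · right
      intro x
      have htop : L ⊔ (ZMod p) ∙ a = ⊤ := by
        apply Submodule.eq_top_of_finrank_eq
        rw [h2]
        have hlt : L < L ⊔ (ZMod p) ∙ a := by
          refine lt_of_le_of_ne le_sup_left fun heq ↦ haL ?_
          rw [heq]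
          exact Submodule.mem_sup_right (Submodule.mem_span_singleton_self a)
        have h1 : finrank (ZMod p) L < finrank (ZMod p) ↥(L ⊔ (ZMod p) ∙ a) :=
          Submodule.finrank_lt_finrank_of_lt hlt
        have h3 : finrank (ZMod p) ↥(L ⊔ (ZMod p) ∙ a) ≤ finrank (ZMod p) A :=
          Submodule.finrank_le _
        omega
      have hx : x ∈ L ⊔ (ZMod p) ∙ a := htop ▸ Submodule.mem_top
      obtain ⟨l, hl, z, hz, rfl⟩ := Submodule.mem_sup.mp hx
      obtain ⟨c, rfl⟩ := Submodule.mem_span_singleton.mp hz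
      have : ρ h (l + c • a) - (l + c • a) = ρ h l - l := by
        rw [map_add, map_smul, ha]; abel
      rw [this]
      exact L.sub_mem (hL h l hl) hl
  -- `H` is not the union of two proper subgroups
  have hcases : (∀ h : H, ∀ x ∈ L, ρ h x = x) ∨ (∀ h : H, ∀ a : A, ρ h a - a ∈ L) := by
    by_cases hA : ∀ h : H, ∀ x ∈ L, ρ h x = x
    · exact Or.inl hA
    · right
      push Not at hA
      obtain ⟨h₁, x₁, hx₁L, hx₁⟩ := hA
      have h₁D : ∀ a : A, ρ h₁ a - a ∈ L :=
        (hdich h₁).resolve_left fun h ↦ hx₁ (h x₁ hx₁L)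
      intro h₂
      by_contra h₂D
      have h₂A : ∀ x ∈ L, ρ h₂ x = x := (hdich h₂).resolve_right h₂D
      rcases hdich (h₁ * h₂) with hP | hP
      · apply hx₁
        have := hP x₁ hx₁L
        rwa [map_mul, Module.End.mul_apply, h₂A x₁ hx₁L] at this
      · apply h₂D
        intro a
        have e1 := hP a
        rw [map_mul, Module.End.mul_apply] at e1
        have e2 := h₁D (ρ h₂ a)
        have : ρ h₂ a - a = (ρ h₁ (ρ h₂ a) - a) - (ρ h₁ (ρ h₂ a) - ρ h₂ a) := by abel
        rw [this]
        exact L.sub_mem e1 e2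
  rcases hcases with hA | hD
  · -- the fixed vectors of `H` form a `Γ`-stable subgroup containing `L`, hence equal to `⊤`
    let B : AddSubgroup A :=
      { carrier := {a | ∀ h ∈ H, h • a = a}
        add_mem' := fun {a b} ha hb h hh ↦ by rw [smul_add, ha h hh, hb h hh]
        zero_mem' := fun h _ ↦ smul_zero h
        neg_mem' := fun {a} ha h hh ↦ by rw [smul_neg, ha h hh] }
    have hBmem : ∀ a : A, a ∈ B ↔ ∀ h ∈ H, h • a = a := fun a ↦ Iff.rfl
    have hBstab : ∀ σ : Γ, ∀ a ∈ B, σ • a ∈ B := by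
      intro σ a ha
      rw [hBmem] at ha ⊢
      intro h hh
      have hconj : σ⁻¹ * h * σ⁻¹⁻¹ ∈ H := hH.conj_mem h hh σ⁻¹
      rw [inv_inv] at hconj
      calc h • σ • a = σ • ((σ⁻¹ * h * σ) • a) := by
            rw [mul_smul, mul_smul, smul_inv_smul]
        _ = σ • a := by rw [ha _ hconj]
    rcases hirr B hBstab with hB | hB
    · exfalso
      apply hx₀
      have hx₀B : x₀ ∈ B := (hBmem x₀).mpr fun h hh ↦ hA ⟨h, hh⟩ x₀ hx₀L
      rw [hB] at hx₀B
      exact (AddSubgroup.mem_bot).mp hx₀B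
    · intro σ hσ a
      have ha : a ∈ B := hB ▸ AddSubgroup.mem_top a
      exact (hBmem a).mp ha σ hσ
  · -- the subgroup generated by the `h • a - a` is `Γ`-stable and inside `L`, hence `⊥`
    let S : Set A := {x | ∃ h ∈ H, ∃ a : A, x = h • a - a}
    have hSL : S ⊆ (L.toAddSubgroup : Set A) := by
      rintro _ ⟨h, hh, a, rfl⟩
      exact hD ⟨h, hh⟩ a
    have hCL : AddSubgroup.closure S ≤ L.toAddSubgroup := (AddSubgroup.closure_le _).mpr hSL
    have hSstab : ∀ σ : Γ, ∀ x ∈ S, σ • x ∈ S := by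
      rintro σ _ ⟨h, hh, a, rfl⟩
      refine ⟨σ * h * σ⁻¹, hH.conj_mem h hh σ, σ • a, ?_⟩
      rw [smul_sub, mul_smul, mul_smul, inv_smul_smul]
    have hCstab : ∀ σ : Γ, ∀ x ∈ AddSubgroup.closure S, σ • x ∈ AddSubgroup.closure S := by
      intro σ x hx
      have hle : AddSubgroup.closure S ≤
          (AddSubgroup.closure S).comap (DistribSMul.toAddMonoidHom A σ) :=
        (AddSubgroup.closure_le _).mpr fun y hy ↦ AddSubgroup.mem_comap.mpr
          (AddSubgroup.subset_closure (hSstab σ y hy))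
      exact AddSubgroup.mem_comap.mp (hle hx)
    rcases hirr (AddSubgroup.closure S) hCstab with hC | hC
    · intro σ hσ a
      have hmem : σ • a - a ∈ AddSubgroup.closure S :=
        AddSubgroup.subset_closure ⟨σ, hσ, a, rfl⟩
      rw [hC, AddSubgroup.mem_bot] at hmem
      exact sub_eq_zero.mp hmem
    · exfalso
      apply hLbt.2
      rw [hC] at hCL
      exact Submodule.toAddSubgroup_eq_top.mp (top_le_iff.mp hCL)


end ZModPlaneNormal

end Literature.RepresentationTheory.FiniteGroups.Representation
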